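import Summits.QuantumFields.YangMills.Theorems.VirialFluxGapFixHtubePhasePackage
import HarnessLib

/-!
# Pieces for the final assembly of ⟨stmt-QuantumFields-24204⟩ `VirialFluxGap.SharpTwistedLaplace`: concrete anchors, the four sign-class
# representatives, and the log of a finite sum of well-logged positive numbers

Helper module (free-hands work of width seat ym-line-sfw-p2-w3 g57, cell ym-idea-1; `--supports 24204`).
* `exists_anchor_frame` — concrete anchors: `ω_C = e₀`, `ω_N = e₁`, `ω_× = e₂` (so `ι ω_× = ι ω_C · ι ω_N = i·j = k`), `C₀ = expPoint((π/2)e₀)`,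
  `N₀ = expPoint((π/2)e₁)` with `su2Quat C₀ = ι ω_C`, `su2Quat N₀ = ι ω_N` and the component relations the phase package wants;
* `exists_pivot` — a twist `z ≠ 0` has a direction `k₀` with `z k₀ = true`;
* `exists_signClass_embedding` — for every `k₀ : Fin 3` an INJECTIVE `Bool × Bool → (Fin 3 → Bool)` with `s k₀ = false` (the four faithful
  representatives of the sign classes, cf. ✓`fixTubes_disjoint`);
* `abs_log_sum_le` — `0 < c_t`, `|log c_t| ≤ B` for all `t` ⇒ `|log Σ_t c_t| ≤ B + log |ι|`.
Everything here is PROVED; no definitions, no named facts.  HONEST FRAMING: bookkeeping; ⟨24204⟩, ⟨24319⟩ and every rung stay OPEN; the Yang–Mills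
mass gap (Clay) is NOT touched; no summit is proved by a line.

## References
* M. Lüscher, *Nucl. Phys. B* 219 (1983) 233–261, §2. [Luscher1983]
-/

set_option autoImplicit false

noncomputable section

open NormedSpace
open scoped RealInnerProductSpace Quaternion BigOperators
open Literature.MathematicalPhysics.QuantumLattice
open Literature.MathematicalPhysics.QuantumFieldTheory hiding SU2 su2Quat_mul
open Literature.MathematicalPhysics.QuantumFieldTheory.Balaban1983to89.T4HaarSU2ExpChart
open Summit.QuantumFields.YangMills.Theorems.FemtoTransferGap
open Summit.QuantumFields.YangMills.Theorems.FemtoTransferGap.TT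

namespace Summit.QuantumFields.YangMills.Theorems.VirialFluxGap.FixSplit

/-! ## §1 Concrete anchors -/

/-- `ι e₂ = ι e₀ · ι e₁` (`k = i·j`). [folklore] -/
theorem imQuat_single_two :
    imQuat (EuclideanSpace.single (2 : Fin 3) (1 : ℝ)) =
      imQuat (EuclideanSpace.single (0 : Fin 3) (1 : ℝ)) * imQuat (EuclideanSpace.single (1 : Fin 3) (1 : ℝ)) := by
  ext <;> simp [imQuat_apply]

/-- `su2Quat (expPoint ((π/2)·ω)) = ι ω` for a unit vector `ω`. [folklore] -/
theorem su2Quat_expPoint_half_pi {ω : EuclideanSpace ℝ (Fin 3)} (hω : ‖ω‖ = 1) :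
    su2Quat (expPoint ((Real.pi / 2) • ω)) = imQuat ω := by
  rw [su2Quat_expPoint, exp_imQuat_smul hω, Real.cos_pi_div_two, Real.sin_pi_div_two, one_smul, Quaternion.coe_zero, zero_add]

/-- ★ **Concrete anchors** with all the relations used by the anchor programme and by the phase package. [cite: Luscher1983, §2] -/
theorem exists_anchor_frame :
    ∃ (ωC ωN ωX : EuclideanSpace ℝ (Fin 3)) (C₀ N₀ : SU2), ‖ωC‖ = 1 ∧ ‖ωN‖ = 1 ∧ ⟪ωC, ωN⟫ = 0 ∧ imQuat ωX = imQuat ωC * imQuat ωN ∧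
      su2Quat C₀ = imQuat ωC ∧ su2Quat N₀ = imQuat ωN ∧ (su2Quat N₀).re = 0 ∧ (su2Quat C₀).re = 0 ∧
      (su2Quat N₀).imI * (su2Quat C₀).imI + (su2Quat N₀).imJ * (su2Quat C₀).imJ + (su2Quat N₀).imK * (su2Quat C₀).imK = 0 := by
  have h0 : ‖EuclideanSpace.single (0 : Fin 3) (1 : ℝ)‖ = 1 := by simp
  have h1 : ‖EuclideanSpace.single (1 : Fin 3) (1 : ℝ)‖ = 1 := by simp
  refine ⟨EuclideanSpace.single 0 1, EuclideanSpace.single 1 1, EuclideanSpace.single 2 1, expPoint ((Real.pi / 2) • EuclideanSpace.single 0 1),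
    expPoint ((Real.pi / 2) • EuclideanSpace.single 1 1), h0, h1, ?_, imQuat_single_two, su2Quat_expPoint_half_pi h0,
    su2Quat_expPoint_half_pi h1, ?_, ?_, ?_⟩
  · rw [EuclideanSpace.inner_single_left]; simp
  · rw [su2Quat_expPoint_half_pi h1, imQuat_re]
  · rw [su2Quat_expPoint_half_pi h0, imQuat_re]
  · rw [su2Quat_expPoint_half_pi h0, su2Quat_expPoint_half_pi h1]
    simp

/-! ## §2 The pivot direction and the four sign-class representatives -/

/-- A non-trivial twist has a twisted direction. [folklore] -/
theorem exists_pivot (z : Fin 3 → Bool) (hz : z ≠ fun _ => false) : ∃ k₀ : Fin 3, z k₀ = true := by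
  by_contra h
  push Not at h
  exact hz (funext fun k => by simpa using h k)

/-- ★ **Four faithful representatives**: an injective `Bool × Bool → (Fin 3 → Bool)` with `s k₀ = false`. [folklore] -/
theorem exists_signClass_embedding (k₀ : Fin 3) :
    ∃ emb : Bool × Bool → (Fin 3 → Bool), Function.Injective emb ∧ ∀ t, emb t k₀ = false := by
  refine ⟨fun t a => if a = k₀ then false else if a = k₀ + 1 then t.1 else t.2, ?_, fun t => by simp⟩
  intro t t' h
  have h1 := congrFun h (k₀ + 1)
  have h2 := congrFun h (k₀ + 2)
  have hk1 : k₀ + 1 ≠ k₀ := by fin_cases k₀ <;> decide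
  have hk2 : k₀ + 2 ≠ k₀ := by fin_cases k₀ <;> decide
  have hk21 : k₀ + 2 ≠ k₀ + 1 := by fin_cases k₀ <;> decide
  simp only [hk1, hk2, hk21, if_false, if_true] at h1 h2
  exact Prod.ext h1 h2

/-! ## §3 Logarithm of a finite sum of well-logged positive numbers -/

/-- ★ `|log Σ_t c_t| ≤ B + log |ι|` if every `c_t > 0` has `|log c_t| ≤ B`. [folklore] -/
theorem abs_log_sum_le {ι : Type*} [Fintype ι] [Nonempty ι] {c : ι → ℝ} {B : ℝ} (hc : ∀ t, 0 < c t) (hB : ∀ t, |Real.log (c t)| ≤ B) :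
    |Real.log (∑ t, c t)| ≤ B + Real.log (Fintype.card ι) := by
  have hB0 : 0 ≤ B := (abs_nonneg _).trans (hB (Classical.arbitrary ι))
  have hcard : (1 : ℝ) ≤ Fintype.card ι := by exact_mod_cast Fintype.card_pos
  have hlogcard : 0 ≤ Real.log (Fintype.card ι) := Real.log_nonneg hcard
  -- each term lies in `[e^{-B}, e^{B}]`
  have hlow : ∀ t, Real.exp (-B) ≤ c t := fun t => by
    have h := (abs_le.mp (hB t)).1
    calc Real.exp (-B) ≤ Real.exp (Real.log (c t)) := Real.exp_le_exp.mpr h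
      _ = c t := Real.exp_log (hc t)
  have hup : ∀ t, c t ≤ Real.exp B := fun t => by
    have h := (abs_le.mp (hB t)).2
    calc c t = Real.exp (Real.log (c t)) := (Real.exp_log (hc t)).symm
      _ ≤ Real.exp B := Real.exp_le_exp.mpr h
  have hpos : 0 < ∑ t, c t := Finset.sum_pos (fun t _ => hc t) Finset.univ_nonempty
  have hsum_up : ∑ t, c t ≤ Fintype.card ι * Real.exp B := by
    calc ∑ t, c t ≤ ∑ _t : ι, Real.exp B := Finset.sum_le_sum fun t _ => hup t
      _ = Fintype.card ι * Real.exp B := by rw [Finset.sum_const, Finset.card_univ, nsmul_eq_mul]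
  have hsum_low : Real.exp (-B) ≤ ∑ t, c t := by
    obtain ⟨t₀⟩ := ‹Nonempty ι›
    calc Real.exp (-B) ≤ c t₀ := hlow t₀
      _ ≤ ∑ t, c t := Finset.single_le_sum (fun t _ => (hc t).le) (Finset.mem_univ t₀)
  rw [abs_le]
  constructor
  · have := Real.log_le_log (Real.exp_pos _) hsum_low
    rw [Real.log_exp] at this
    linarith
  · have := Real.log_le_log hpos hsum_up
    rw [Real.log_mul (by positivity) (Real.exp_pos _).ne', Real.log_exp] at this
    linarith

/-- Representatives are hit: an injective `Bool × Bool → (Fin 3 → Bool)` with `s k₀ = false`, ONTO the sign classes with `s k₀ = false`.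
[folklore] -/
theorem exists_signClass_embedding_surj (k₀ : Fin 3) :
    ∃ emb : Bool × Bool → (Fin 3 → Bool), Function.Injective emb ∧ (∀ t, emb t k₀ = false) ∧
      ∀ s : Fin 3 → Bool, s k₀ = false → ∃ t, emb t = s := by
  refine ⟨fun t a => if a = k₀ then false else if a = k₀ + 1 then t.1 else t.2, ?_, fun t => by simp, ?_⟩
  · intro t t' h
    have h1 := congrFun h (k₀ + 1)
    have h2 := congrFun h (k₀ + 2)
    have hk1 : k₀ + 1 ≠ k₀ := by fin_cases k₀ <;> decide
    have hk2 : k₀ + 2 ≠ k₀ := by fin_cases k₀ <;> decide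
    have hk21 : k₀ + 2 ≠ k₀ + 1 := by fin_cases k₀ <;> decide
    simp only [hk1, hk2, hk21, if_false, if_true] at h1 h2
    exact Prod.ext h1 h2
  · intro s hs
    refine ⟨(s (k₀ + 1), s (k₀ + 2)), funext fun a => ?_⟩
    fin_cases k₀ <;> fin_cases a <;> simp_all (config := { decide := true })


end Summit.QuantumFields.YangMills.Theorems.VirialFluxGap.FixSplit

end
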